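import Summits.NavierStokesRegularity.NavierStokesRegularity.Theses.CorkscrewDynamo

/-!
# Route CorkscrewDynamo — `Assembly` (item stmt-NavierStokesRegularity-11286)

`Assembly` is by definition the implication
`CorkscrewProfile → RdssProfileTruncation → ClayUniqueness → ¬ NavierStokesRegularity`,
stated by name over the route's own decls, i.e. literally the type of the route's deciding
theorem `closes` (D-0027 §2.1, rendered at the end of the route file). The proof is that theorem:
the corkscrew is a nontrivial Type-I rotated-DSS ancient mild profile, the conjecture-free rotated
truncation bridge gives a rapidly decaying datum with a finite-lifespan Leray–Hopf classical
solution, and Clay (A) + Clay-class uniqueness extend it past its lifespan, contradicting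
maximality.
-/

-- the summit and its single sub-problem share the name (CONVENTIONS §1), as in every Theorems file
set_option linter.dupNamespace false

namespace Summit.NavierStokesRegularity.NavierStokesRegularity.Theorems

open Summit.NavierStokesRegularity.NavierStokesRegularity.Theses.CorkscrewDynamo

/-- **Assembly of route `CorkscrewDynamo`** (item stmt-NavierStokesRegularity-11286):
`CorkscrewProfile → RdssProfileTruncation → ClayUniqueness → ¬ NavierStokesRegularity`.
This is exactly the route's deciding theorem `Theses.CorkscrewDynamo.closes` (pure logic:
Clay (A) on the datum of the finite-lifespan solution produced by the bridge from the corkscrew,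
Clay-class uniqueness on `[0, T)`, restriction of the global solution to `[0, T + 1)` against
maximality). -/
theorem corkscrewDynamo_assembly_proof :
    Summit.NavierStokesRegularity.NavierStokesRegularity.Theses.CorkscrewDynamo.Assembly := by
  unfold Assembly
  exact closes

end Summit.NavierStokesRegularity.NavierStokesRegularity.Theorems
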